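import Literature.NumberTheory.Transcendental.KaehlerHodge
import Literature.Geometry.Kaehler.HodgeStarProofs
import Literature.Geometry.Kaehler.HodgeStarInjectiveProofs
import Literature.NumberTheory.Transcendental.ComplexFormsProofs
import HarnessLib

/-!
# The conj-atlas plane: `cHodgeLaplacian_eq_two_smul_dolbeaultLaplacian` is false as stated

Companion of `Literature/NumberTheory/Transcendental/KaehlerHodge.lean` (see its module docstring,
*Correction (D-0014 provefact pass on `cHodgeLaplacian_eq_two_smul_dolbeaultLaplacian`)*): an
explicit, fully computed counterexample to the named fact
`Literature.NumberTheory.Transcendental.cHodgeLaplacian_eq_two_smul_dolbeaultLaplacian` (the Kähler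
identity `Δ_d = 2Δ_∂̄`, Voisin (2002), Thm. 6.7) **as elaborated**.

## What is refuted, and why it matters

The `def cHodgeLaplacian_eq_two_smul_dolbeaultLaplacian g o : Prop` sits in a section with the
instance variables `[IsManifold 𝓘(ℂ, E) ω M] [IsManifold 𝓘(ℝ, E) ∞ M]`, but its body only uses the
real structure (through the type of the metric `g`): a `def` abstracts only the section variables
it mentions, so the holomorphic atlas `[IsManifold 𝓘(ℂ, E) ω M]` is **not** among its binders
(`{E} [NormedAddCommGroup E] [NormedSpace ℂ E] {M} [TopologicalSpace M] [ChartedSpace E M] {k m}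
[FiniteDimensional ℂ E] {n} [Fact (finrank ℝ E = n)] [IsManifold 𝓘(ℝ, E) ∞ M] (g) (o)`). The fact
therefore quantifies over every *real* `C^∞` manifold charted on the complex vector space `E`. On
such a manifold the chart-wise complex structure `tangentJ` (multiplication by `i` in the preferred
chart `chartAt x`), and with it `IsOfType`, `typeComponent`, `∂ = dolbeault`, `∂̄ = dolbeaultBar`
and `Δ_∂̄ = dolbeaultLaplacian`, are not tensors: they jump with the choice of preferred chart,
while `d = mextDeriv`, the Hodge star and `Δ_d = cHodgeLaplacian` are honest. In that generality
the statement is false (this file), so no proof `cHodgeLaplacian_eq_two_smul_dolbeaultLaplacian_holds`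
can exist; the intended statement for complex manifolds is the corrected named fact
`Literature.NumberTheory.Transcendental.cHodgeLaplacian_eq_two_smul_dolbeaultLaplacian_of_isManifold_complex`
(`KaehlerHodge.lean`, end of file), a genuine theorem (Voisin (2002), Thm. 6.7; Huybrechts
(2005), Prop. 3.1.12 (iii)) awaiting the Kähler identities.

* `ConjPlane.not_cHodgeLaplacian_eq_two_smul_dolbeaultLaplacian`: the fact fails at the instance
  `E = ℂ`, `M = ConjPlane`, `n = 2`, `k = 0`, `m = 2`, `g = flatMetric`, `o = orient` — an instance of
  the fact's *own* binders, so no closed proof `cHodgeLaplacian_eq_two_smul_dolbeaultLaplacian_holds`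
  can exist. The universal closure over exactly those binders is already recorded in the tree as
  `Literature.NumberTheory.Transcendental.not_cHodgeLaplacian_eq_two_smul_dolbeaultLaplacian`
  (`KaehlerHodgeHarmonicCounterexample.lean`, witnessed independently on the `{id, conj}`-rigged
  torus of `KaehlerHodgeDolbeaultHarmonicCounterexample.lean`, in degree `k = 2`); the present file
  is the elementary degree-`0` plane witness described in the *Correction* note of `KaehlerHodge.lean`
  (one chart flip along the real axis, one test function), a second, self-contained certificate.

## The counterexample (`namespace ConjPlane`)

`ConjPlane` is `ℂ` (a type synonym) with the **conj-atlas**: the two global charts `id` and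
`conj`, the preferred chart being `id` on the closed upper half plane and `conj` on the open lower
half plane. Its transition map `conj` is real-linear, so `ConjPlane` is a real `C^∞` manifold
(`IsManifold 𝓘(ℝ, ℂ) ∞ ConjPlane`), but not holomorphic; the chart-wise complex structure is `+i`
above the real axis and `-i` below (in genuine coordinates). Then, with `σ_p ∈ {id, conj}` the
frame map of the chart at `p` and `ε_p = ±1` its sign:

* the flat metric `re v re w + im v im w` is a *smooth* Riemannian metric `flatMetric` (a
  `Bundle.ContMDiffRiemannianMetric`: in both trivialisations its matrix is the constant identity,
  `conj` being orthogonal), it is Hermitian for `±i`, and its Kähler form is closed because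
  `3`-forms vanish in real dimension `2` — so `hg : IsKaehler` holds (`isKaehler_flatMetric`);
* the orientation family `orient` is the orientation of the frame `(1, ε i)` read in the chart at
  each point, i.e. the standard orientation of `ℂ` reversed below the axis together with the chart,
  so that the Riemannian volume form is the genuine `dx ∧ dy`: its chart representatives are
  constant (`inChart_riemannianVolumeForm`) and `ho` holds (`isSmoothForm_riemannianVolumeForm`);
* the tangent coordinate changes are `σ_y ∘ σ_x` (`tangentCoordChange_eq`), the chart
  representative of a form is its value pulled back along them (`inChart_apply_eq`), and the
  manifold exterior derivative is Mathlib's `extDeriv` of the representative (`mextDeriv_apply_eq`);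
* `f = (re z)²` is a smooth `0`-form `f0` (`re ∘ conj = re`), `df = 2x dx` in every chart
  (`mextDeriv_f0`), `(df)^{0,1} = ∂̄f = x dz̄` (`dolbeaultBar_f0`, via the discharged type-projection
  facts of `ComplexFormsProofs.lean`), and `⋆dx = ε dy`, `⋆dy = -ε dx` (`hodgeStar_DX/DY`, via the
  discharged two-dimensional check `hodgeStar_apply_eq_areaForm_holds`), whence
  `⋆∂̄f = ± i x dz̄ =: β` and `⋆df = ± 2x dy =: γ` (`cHodgeStar_η01`, `cHodgeStar_η`);
* **the junk zero.** `β` has type `(0,1)` everywhere, so `∂β = (dβ)^{1,1}` (`dolbeault_β`); but the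
  chart representative of `β` at the point `1` is `i (re y) conj w` above the axis and
  `-i (re y) w` below it (`inChart_β_c1_apply_of_nonneg/_of_neg`) — discontinuous at `1`, hence
  not differentiable (`not_differentiableAt_inChart_β`), so Mathlib's `fderiv`-based `mextDeriv`
  returns `0` there (`mextDeriv_β_c1`) and `2Δ_∂̄ f (1) = -2⋆∂(⋆∂̄f)(1) = 0`
  (`two_smul_dolbeaultLaplacian_f0_c1`);
* **the genuine side.** The representative of `γ` at `1` is the smooth `2x dy` (the orientation
  flip is undone by the transition derivative), `d⋆df (1) = 2 dx ∧ dy` (`re_mextDeriv_γ_c1`), and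
  `Δ_d f (1) = -⋆(2 dx ∧ dy) ≠ 0` by injectivity of `⋆` (`hodgeStar_injective_holds`;
  `cHodgeLaplacian_f0_c1_ne`).

Hence `Δ_d f ≠ 2Δ_∂̄ f` (`cHodgeLaplacian_f0_ne`) although all hypotheses of the fact hold.

## Design notes

* `set_option backward.isDefEq.respectTransparency false` is set for the whole file: as in
  Mathlib's `riemannianMetricVectorSpace` and in `Geometry/Kaehler/RiemannianHodgeRoughMetric.lean`,
  unification must see through the semireducible `TangentSpace 𝓘(ℝ, ℂ) x = ℂ` when model-space
  forms (`DX`, `DZBAR`, `Ωr`, …) are used at tangent-space types and when the metric is installed.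
* Tangent vectors are retyped as complex numbers with `show ℂ from v`; values of forms are always
  computed through explicit `_apply` lemmas and `change`, never by `simp` across the synonym.
* No global instance is registered on an existing type: `ConjPlane` is a new type synonym carrying
  its own `TopologicalSpace`/`ChartedSpace`/`IsManifold` instances; the Riemannian bundle
  `flatBundle` (the very instance the fact installs by `letI`) and Mathlib's
  `Complex.finrank_real_complex_fact` are *local* instances of the namespace, re-supplied explicitly
  in the closing theorem.
* The same witness refutes neither `dolbeaultLaplacian_eq_delLaplacian` (for `0`-forms the junk
  zeros of `Δ_∂` and `Δ_∂̄` occur at the same boundary points) nor anything about complex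
  manifolds; it only certifies that the dropped binder matters.

## References

* C. Voisin, *Hodge Theory and Complex Algebraic Geometry I* (2002), §6.1.2, Thm. 6.7 (p. 141):
  "Let `(X, ω)` be a Kähler manifold … `Δ_∂ = Δ_∂̄ = ½Δ_d`" — `X` a *complex* manifold.
* D. Huybrechts, *Complex Geometry. An Introduction* (2005), Prop. 3.1.12 (iii) (p. 120): "Let `X`
  be a complex manifold endowed with a Kähler metric `g` … `Δ_∂ = Δ_∂̄ = ½Δ`".
-/

noncomputable section

-- Unification must see through the semireducible `TangentSpace 𝓘(ℝ, ℂ) x = ℂ` throughout (model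
-- forms at tangent-space types, the `letI` metric); cf. Mathlib's `riemannianMetricVectorSpace`.
set_option backward.isDefEq.respectTransparency false

open scoped Manifold ContDiff Topology ComplexConjugate
open Bundle Module Set Filter

namespace Literature.NumberTheory.Transcendental

/-- The **conj-atlas plane**: the complex line `ℂ` as a topological space, to be equipped with the
real-smooth, non-holomorphic two-chart atlas `{id, conj}`. [folklore] -/
def ConjPlane : Type := ℂ

namespace ConjPlane

/-- The topology of `ℂ`. [folklore] -/
instance : TopologicalSpace ConjPlane := inferInstanceAs (TopologicalSpace ℂ)

/-- The underlying complex number of a point of the conj-atlas plane. [folklore] -/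
def val : ConjPlane → ℂ := id

/-- The point of the conj-atlas plane with given underlying complex number. [folklore] -/
def mk : ℂ → ConjPlane := id

/-- `val ∘ mk = id`. [folklore] -/
@[simp] theorem val_mk (z : ℂ) : val (mk z) = z := rfl
/-- `mk ∘ val = id`. [folklore] -/
@[simp] theorem mk_val (p : ConjPlane) : mk (val p) = p := rfl

/-- `val` is continuous (it is the identity). [folklore] -/
theorem continuous_val : Continuous val := continuous_id
/-- `mk` is continuous (it is the identity). [folklore] -/
theorem continuous_mk : Continuous mk := continuous_id

/-- `val` as a homeomorphism. [folklore] -/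
def valHomeomorph : ConjPlane ≃ₜ ℂ where
  toFun := val
  invFun := mk
  left_inv _ := rfl
  right_inv _ := rfl
  continuous_toFun := continuous_val
  continuous_invFun := continuous_mk

/-- The identity chart. [folklore] -/
def idChart : OpenPartialHomeomorph ConjPlane ℂ := valHomeomorph.toOpenPartialHomeomorph

/-- The conjugation chart. [folklore] -/
def conjChart : OpenPartialHomeomorph ConjPlane ℂ :=
  (valHomeomorph.trans Complex.conjCLE.toHomeomorph).toOpenPartialHomeomorph

/-- The identity chart is `val`. [folklore] -/
@[simp] theorem idChart_apply (p : ConjPlane) : idChart p = val p := rfl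
/-- The inverse of the identity chart is `mk`. [folklore] -/
@[simp] theorem idChart_symm_apply (z : ℂ) : idChart.symm z = mk z := rfl
/-- The conjugation chart is `conj ∘ val`. [folklore] -/
@[simp] theorem conjChart_apply (p : ConjPlane) : conjChart p = conj (val p) := rfl
/-- The inverse of the conjugation chart is `mk ∘ conj`. [folklore] -/
@[simp] theorem conjChart_symm_apply (z : ℂ) : conjChart.symm z = mk (conj z) := rfl
/-- The identity chart is global. [folklore] -/
@[simp] theorem idChart_source : idChart.source = univ := rfl
/-- The conjugation chart is global. [folklore] -/
@[simp] theorem conjChart_source : conjChart.source = univ := rfl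
/-- The identity chart is onto `ℂ`. [folklore] -/
@[simp] theorem idChart_target : idChart.target = univ := rfl
/-- The conjugation chart is onto `ℂ`. [folklore] -/
@[simp] theorem conjChart_target : conjChart.target = univ := rfl

/-- The upper closed half plane carries the identity chart, the open lower half plane the
conjugation chart. [folklore] -/
def up (p : ConjPlane) : Prop := 0 ≤ (val p).im

/-- Membership in the closed upper half plane is decidable (classically, as for `≤` on `ℝ`). [folklore] -/
instance (p : ConjPlane) : Decidable (up p) := inferInstanceAs (Decidable (0 ≤ (val p).im))

/-- The **conj-atlas**: the two global charts `id` and `conj` on `ℂ`, the preferred chart being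
`id` on the closed upper half plane and `conj` on the open lower half plane. The transition map
`conj` is real-linear (so this is a real `C^∞` atlas, `IsManifold 𝓘(ℝ, ℂ) ∞ ConjPlane` below) but
not holomorphic: `ConjPlane` is *not* a complex manifold, and the chart-wise complex structure
`tangentJ` (multiplication by `i` in the preferred chart) is `+i` above the real axis and `-i`
below it. [folklore] -/
instance : ChartedSpace ℂ ConjPlane where
  atlas := {idChart, conjChart}
  chartAt p := if up p then idChart else conjChart
  mem_chart_source p := by
    by_cases h : up p <;> simp [h]
  chart_mem_atlas p := by
    by_cases h : up p <;> simp [h]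

/-- The preferred chart at `p` (by definition). [folklore] -/
theorem chartAt_eq (p : ConjPlane) : chartAt ℂ p = if up p then idChart else conjChart := rfl

/-- The atlas consists of the two charts `idChart`, `conjChart`. [folklore] -/
theorem mem_atlas_iff {e : OpenPartialHomeomorph ConjPlane ℂ} :
    e ∈ atlas ℂ ConjPlane ↔ e = idChart ∨ e = conjChart := by
  change e ∈ ({idChart, conjChart} : Set (OpenPartialHomeomorph ConjPlane ℂ)) ↔ _
  simp

/-- The frame map of the chart at `p`: the identity on the closed upper half plane, complex
conjugation below (as a real continuous linear map of `ℂ`). [folklore] -/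
def σ (p : ConjPlane) : ℂ →L[ℝ] ℂ :=
  if up p then ContinuousLinearMap.id ℝ ℂ else Complex.conjCLE.toContinuousLinearMap

/-- On the closed upper half plane the frame map is the identity. [folklore] -/
theorem σ_of_up {p : ConjPlane} (h : up p) : σ p = ContinuousLinearMap.id ℝ ℂ := if_pos h
/-- On the open lower half plane the frame map is `conj`. [folklore] -/
theorem σ_of_not_up {p : ConjPlane} (h : ¬ up p) :
    σ p = Complex.conjCLE.toContinuousLinearMap := if_neg h

/-- The frame maps are involutions. [folklore] -/
@[simp] theorem σ_σ (p : ConjPlane) (z : ℂ) : σ p (σ p z) = z := by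
  by_cases h : up p
  · simp [σ_of_up h]
  · simp [σ_of_not_up h]

/-- The frame maps are involutions (composition form). [folklore] -/
theorem σ_comp_σ (p : ConjPlane) : (σ p).comp (σ p) = ContinuousLinearMap.id ℝ ℂ := by
  ext1 z; simp

/-- The frame maps preserve real parts. [folklore] -/
@[simp] theorem re_σ (p : ConjPlane) (z : ℂ) : (σ p z).re = z.re := by
  by_cases h : up p
  · simp [σ_of_up h]
  · simp [σ_of_not_up h]

/-- The preferred chart at `p` is `σ_p ∘ val`. [folklore] -/
@[simp] theorem chartAt_apply (p q : ConjPlane) : chartAt ℂ p q = σ p (val q) := by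
  by_cases h : up p
  · rw [chartAt_eq, if_pos h, σ_of_up h]; rfl
  · rw [chartAt_eq, if_neg h, σ_of_not_up h]; rfl

/-- The inverse of the preferred chart at `p` is `mk ∘ σ_p`. [folklore] -/
@[simp] theorem chartAt_symm_apply (p : ConjPlane) (z : ℂ) : (chartAt ℂ p).symm z = mk (σ p z) := by
  by_cases h : up p
  · rw [chartAt_eq, if_pos h, σ_of_up h]; rfl
  · rw [chartAt_eq, if_neg h, σ_of_not_up h]; rfl

/-- The preferred charts are global. [folklore] -/
@[simp] theorem chartAt_source (p : ConjPlane) : (chartAt ℂ p).source = univ := by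
  by_cases h : up p
  · rw [chartAt_eq, if_pos h]; rfl
  · rw [chartAt_eq, if_neg h]; rfl

/-- The preferred charts are onto `ℂ`. [folklore] -/
@[simp] theorem chartAt_target (p : ConjPlane) : (chartAt ℂ p).target = univ := by
  by_cases h : up p
  · rw [chartAt_eq, if_pos h]; rfl
  · rw [chartAt_eq, if_neg h]; rfl

/-- The extended chart at `p` is `σ_p ∘ val` (the model with corners is trivial). [folklore] -/
theorem extChartAt_apply (p q : ConjPlane) : extChartAt 𝓘(ℝ, ℂ) p q = σ p (val q) := by
  simp

/-- The inverse extended chart at `p` is `mk ∘ σ_p`. [folklore] -/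
theorem extChartAt_symm_apply (p : ConjPlane) (z : ℂ) :
    (extChartAt 𝓘(ℝ, ℂ) p).symm z = mk (σ p z) := by
  simp

/-- The transition map from the chart at `x` to the chart at `y` is the linear map `σ_y ∘ σ_x`. [folklore] -/
theorem chartAt_comp_chartAt_symm (x y : ConjPlane) :
    (chartAt ℂ y) ∘ (chartAt ℂ x).symm = ⇑((σ y).comp (σ x)) := by
  funext w
  simp

/-- The derivative of a transition map is `σ_y ∘ σ_x`. [folklore] -/
@[simp] theorem fderiv_chartAt_comp_chartAt_symm (x y : ConjPlane) (w : ℂ) :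
    fderiv ℝ ((chartAt ℂ y) ∘ (chartAt ℂ x).symm) w = (σ y).comp (σ x) := by
  rw [chartAt_comp_chartAt_symm]
  exact ((σ y).comp (σ x)).fderiv

/-- The extended charts are global. [folklore] -/
@[simp] theorem extChartAt_source' (p : ConjPlane) : (extChartAt 𝓘(ℝ, ℂ) p).source = univ := by
  simp

/-- The extended charts are onto `ℂ`. [folklore] -/
@[simp] theorem extChartAt_target' (p : ConjPlane) : (extChartAt 𝓘(ℝ, ℂ) p).target = univ := by
  simp

/-- `conj⁻¹ = conj`. [folklore] -/
@[simp] theorem conjCLE_symm_apply (z : ℂ) : Complex.conjCLE.symm z = conj z := by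
  rw [ContinuousLinearEquiv.symm_apply_eq]
  simp

/-- Every chart of the atlas is `val` followed by a real-linear automorphism of `ℂ`. [folklore] -/
theorem exists_linear_of_mem_atlas {e : OpenPartialHomeomorph ConjPlane ℂ} (he : e ∈ atlas ℂ ConjPlane) :
    ∃ L : ℂ ≃L[ℝ] ℂ, (∀ q, e q = L (val q)) ∧ (∀ z, e.symm z = mk (L.symm z)) ∧ e.source = univ := by
  rcases mem_atlas_iff.1 he with rfl | rfl
  · exact ⟨ContinuousLinearEquiv.refl ℝ ℂ, fun q ↦ rfl, fun z ↦ rfl, rfl⟩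
  · exact ⟨Complex.conjCLE, fun q ↦ rfl, fun z ↦ by simp, rfl⟩

/-- The conj-atlas plane is a real `C^∞` manifold (its transition maps are `id` and `conj`). [folklore] -/
instance : IsManifold 𝓘(ℝ, ℂ) ∞ ConjPlane := by
  apply isManifold_of_contDiffOn
  intro e e' he he'
  obtain ⟨L, hL, hLs, -⟩ := exists_linear_of_mem_atlas he
  obtain ⟨L', hL', hL's, -⟩ := exists_linear_of_mem_atlas he'
  apply ((L' : ℂ →L[ℝ] ℂ).contDiff.comp (L.symm : ℂ →L[ℝ] ℂ).contDiff).contDiffOn.congr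
  intro z hz
  simp [Function.comp_def, hL', hLs]

/-! ### The flat metric -/

/-- The flat inner product `re v re w + im v im w` of `ℂ = ℝ²`, as a continuous bilinear form. [folklore] -/
def flatInner : ℂ →L[ℝ] ℂ →L[ℝ] ℝ :=
  (ContinuousLinearMap.mul ℝ ℝ).bilinearComp Complex.reCLM Complex.reCLM +
    (ContinuousLinearMap.mul ℝ ℝ).bilinearComp Complex.imCLM Complex.imCLM

/-- Unfolding of `flatInner`. [folklore] -/
@[simp] theorem flatInner_apply (v w : ℂ) : flatInner v w = v.re * w.re + v.im * w.im := by
  simp [flatInner]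

/-- `flatInner v v = ‖v‖²`. [folklore] -/
theorem flatInner_self (v : ℂ) : flatInner v v = ‖v‖ ^ 2 := by
  rw [flatInner_apply, ← Complex.normSq_eq_norm_sq, Complex.normSq_apply]

/-- The flat inner product is invariant under the frame maps `σ` (`conj` is orthogonal). [folklore] -/
theorem flatInner_σ (p : ConjPlane) (v w : ℂ) : flatInner (σ p v) (σ p w) = flatInner v w := by
  by_cases h : up p
  · simp [σ_of_up h]
  · simp [σ_of_not_up h]

/-- The tangent coordinate changes of the conj-atlas plane are the compositions `σ_y ∘ σ_x`
(`id` between points carrying the same chart, `conj` otherwise). [folklore] -/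
theorem tangentCoordChange_eq (x y z : ConjPlane) :
    tangentCoordChange 𝓘(ℝ, ℂ) x y z = (σ y).comp (σ x) := by
  rw [tangentCoordChange_def]
  simp

/-- The flat metric `re v re w + im v im w` on the tangent spaces of the conj-atlas plane, as a
smooth (`C^∞`) Riemannian metric: in both trivialisations its matrix is the constant identity,
`conj` being orthogonal. [folklore] -/
def flatMetric :
    ContMDiffRiemannianMetric 𝓘(ℝ, ℂ) ∞ ℂ (fun x : ConjPlane ↦ TangentSpace 𝓘(ℝ, ℂ) x) where
  inner _ := (flatInner : ℂ →L[ℝ] ℂ →L[ℝ] ℝ)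
  symm _ v w := by
    change flatInner v w = flatInner w v
    rw [flatInner_apply, flatInner_apply]
    ring
  pos _ v hv := by
    change 0 < flatInner v v
    rw [flatInner_self]
    have : (v : ℂ) ≠ 0 := hv
    positivity
  isVonNBounded _ := by
    change Bornology.IsVonNBounded ℝ {v : ℂ | flatInner v v < 1}
    refine (NormedSpace.isVonNBounded_ball ℝ ℂ 1).subset ?_
    intro v hv
    rw [mem_setOf_eq, flatInner_self] at hv
    rw [Metric.mem_ball, dist_zero_right]
    exact (pow_lt_one_iff_of_nonneg (norm_nonneg v) two_ne_zero).1 hv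
  contMDiff := by
    intro x₀
    rw [contMDiffAt_section]
    have key : (fun x : ConjPlane ↦ (trivializationAt (ℂ →L[ℝ] ℂ →L[ℝ] ℝ)
        (fun b : ConjPlane ↦ TangentSpace 𝓘(ℝ, ℂ) b →L[ℝ] TangentSpace 𝓘(ℝ, ℂ) b →L[ℝ] ℝ) x₀
          ⟨x, (flatInner : ℂ →L[ℝ] ℂ →L[ℝ] ℝ)⟩).2) = fun _ ↦ flatInner := by
      funext x
      ext v w
      simp [hom_trivializationAt_apply, ContinuousLinearMap.inCoordinates]
      change flatInner (σ x (σ x₀ v)) (σ x (σ x₀ w)) = _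
      rw [flatInner_σ, flatInner_σ, flatInner_apply]
    rw [key]
    exact contMDiffAt_const

/-- The flat Riemannian bundle structure on the tangent spaces of the conj-atlas plane (the
instance installed by the `letI` of the fact; a `def`, used as a *local* instance only). [folklore] -/
@[reducible] def flatBundle : RiemannianBundle (fun x : ConjPlane ↦ TangentSpace 𝓘(ℝ, ℂ) x) :=
  ⟨flatMetric.toRiemannianMetric⟩

attribute [local instance] flatBundle Complex.finrank_real_complex_fact

local notation "T" => TangentSpace 𝓘(ℝ, ℂ)

/-- The inner product of the local Riemannian structure is the flat one (by construction). [folklore] -/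
theorem inner_eq (p : ConjPlane) (v w : T p) : inner ℝ v w = flatInner v w := rfl

/-- The flat metric is Hermitian for the chart-wise complex structure `J = i` (it is invariant
under `±i`). [folklore] -/
theorem isHermitian_flatMetric : flatMetric.toRiemannianMetric.IsHermitian := by
  intro x v w
  change flatInner (Literature.Geometry.Kaehler.tangentJ ℂ x v)
    (Literature.Geometry.Kaehler.tangentJ ℂ x w) = flatInner v w
  rw [Literature.Geometry.Kaehler.tangentJ_apply, Literature.Geometry.Kaehler.tangentJ_apply,
    flatInner_apply, flatInner_apply]
  simp
  ring

/-- The flat metric is Kähler in the sense of `IsKaehler`: Hermitian, and its Kähler form is closed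
because every `3`-form on a real `2`-manifold vanishes. [folklore] -/
theorem isKaehler_flatMetric : flatMetric.toRiemannianMetric.IsKaehler :=
  ⟨isHermitian_flatMetric,
    Literature.Geometry.Kaehler.MForm.eq_zero_of_finrank_lt (n := 2) (j := 0) _⟩

/-! ### Orientation and volume form -/

/-- The sign of the chart at `p`: `+1` on the closed upper half plane, `-1` below. [folklore] -/
def ε (p : ConjPlane) : ℝ := if up p then 1 else -1

/-- `ε = 1` on the closed upper half plane. [folklore] -/
theorem ε_of_up {p : ConjPlane} (h : up p) : ε p = 1 := if_pos h
/-- `ε = -1` on the open lower half plane. [folklore] -/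
theorem ε_of_not_up {p : ConjPlane} (h : ¬ up p) : ε p = -1 := if_neg h

/-- `ε² = 1`. [folklore] -/
@[simp] theorem ε_mul_ε (p : ConjPlane) : ε p * ε p = 1 := by
  by_cases h : up p
  · simp [ε_of_up h]
  · simp [ε_of_not_up h]

/-- `ε ≠ 0`. [folklore] -/
theorem ε_ne_zero (p : ConjPlane) : ε p ≠ 0 := by
  by_cases h : up p
  · simp [ε_of_up h]
  · simp [ε_of_not_up h]

/-- The frame maps multiply imaginary parts by `ε`. [folklore] -/
@[simp] theorem im_σ (p : ConjPlane) (z : ℂ) : (σ p z).im = ε p * z.im := by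
  by_cases h : up p
  · simp [σ_of_up h, ε_of_up h]
  · simp [σ_of_not_up h, ε_of_not_up h]

/-- The frame `(1, ±i)` of the tangent space at `p` (sign `ε p`). [folklore] -/
def frame (p : ConjPlane) : Fin 2 → T p := ![(1 : ℂ), ((ε p : ℂ) * Complex.I : ℂ)]

/-- The frame `(1, ±i)` is orthonormal for the flat metric. [folklore] -/
theorem orthonormal_frame (p : ConjPlane) : Orthonormal ℝ (frame p) := by
  rw [orthonormal_iff_ite]
  intro i j
  fin_cases i <;> fin_cases j
  · rw [inner_eq, flatInner_apply]; simp [frame]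
  · rw [inner_eq, flatInner_apply]; simp [frame]
  · rw [inner_eq, flatInner_apply]; simp [frame]
  · rw [inner_eq, flatInner_apply]; simp [frame]

/-- The tangent spaces of the conj-atlas plane are `2`-dimensional. [folklore] -/
theorem finrank_tangentSpace (p : ConjPlane) : finrank ℝ (T p) = 2 := Complex.finrank_real_complex

/-- The frame as an orthonormal basis of the tangent space at `p`. [folklore] -/
def onb (p : ConjPlane) : OrthonormalBasis (Fin 2) ℝ (T p) :=
  (basisOfOrthonormalOfCardEqFinrank (orthonormal_frame p)
    (by rw [finrank_tangentSpace]; simp)).toOrthonormalBasis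
    (by simpa using orthonormal_frame p)

/-- The orthonormal basis is the frame. [folklore] -/
@[simp]
theorem onb_apply (p : ConjPlane) : ⇑(onb p) = frame p := by
  simp [onb]

/-- The orientation family: at `p` the orientation of the frame `(1, ±i)`, i.e. the standard
orientation of `ℂ` read in the chart at `p` (reversed below the real axis, where the chart is
`conj`), so that the Riemannian volume form is the genuine `dx ∧ dy` everywhere. [folklore] -/
def orient : (x : ConjPlane) → Orientation ℝ (T x) (Fin 2) := fun p ↦ (onb p).toBasis.orientation

/-- The volume form at `p` is `ε p · (v₁ w₂ - v₂ w₁)` in the chart at `p`. [folklore] -/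
theorem volumeForm_apply (p : ConjPlane) (v w : T p) :
    (orient p).volumeForm ![v, w] =
      ε p * (Complex.re v * Complex.im w - Complex.im v * Complex.re w) := by
  rw [Orientation.volumeForm_robust (orient p) (onb p) rfl, Basis.det_apply, Matrix.det_fin_two]
  simp only [Basis.toMatrix_apply, OrthonormalBasis.coe_toBasis_repr_apply,
    OrthonormalBasis.repr_apply_apply, onb_apply, inner_eq, flatInner_apply]
  simp [frame]
  ring

/-! ### Chart representatives and the exterior derivative on the conj-atlas plane -/

/-- The inverse extended chart at `p` is `mk ∘ σ_p`, with manifold derivative `σ_q ∘ σ_p` at the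
point `y` (`q` the image point): the derivative of the transition map to the chart at `q`. [folklore] -/
theorem hasMFDerivAt_extChartAt_symm (p : ConjPlane) (y : ℂ) :
    HasMFDerivAt 𝓘(ℝ, ℂ) 𝓘(ℝ, ℂ) (extChartAt 𝓘(ℝ, ℂ) p).symm y
      ((σ ((extChartAt 𝓘(ℝ, ℂ) p).symm y)).comp (σ p)) := by
  refine ⟨?_, ?_⟩
  · have : ((extChartAt 𝓘(ℝ, ℂ) p).symm : ℂ → ConjPlane) = mk ∘ (σ p) :=
      funext (extChartAt_symm_apply p)
    rw [this]
    exact (continuous_mk.comp (σ p).continuous).continuousAt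
  · have : writtenInExtChartAt 𝓘(ℝ, ℂ) 𝓘(ℝ, ℂ) y (extChartAt 𝓘(ℝ, ℂ) p).symm =
        ⇑((σ ((extChartAt 𝓘(ℝ, ℂ) p).symm y)).comp (σ p)) := by
      funext w
      simp [writtenInExtChartAt]
    rw [this]
    exact (ContinuousLinearMap.hasFDerivAt _).hasFDerivWithinAt

/-- The derivative of the inverse extended chart within `range 𝓘(ℝ, ℂ) = univ`. [folklore] -/
theorem mfderivWithin_extChartAt_symm (p : ConjPlane) (y : ℂ) :
    mfderivWithin 𝓘(ℝ, ℂ) 𝓘(ℝ, ℂ) (extChartAt 𝓘(ℝ, ℂ) p).symm (range 𝓘(ℝ, ℂ)) y =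
      (σ ((extChartAt 𝓘(ℝ, ℂ) p).symm y)).comp (σ p) := by
  rw [modelWithCornersSelf_coe, range_id, mfderivWithin_univ]
  exact (hasMFDerivAt_extChartAt_symm p y).mfderiv

/-- The extended chart at `p` has manifold derivative the identity at `p` (it is read in its own
trivialisation). [folklore] -/
theorem hasMFDerivAt_extChartAt (p : ConjPlane) :
    HasMFDerivAt 𝓘(ℝ, ℂ) 𝓘(ℝ, ℂ) (extChartAt 𝓘(ℝ, ℂ) p) p (ContinuousLinearMap.id ℝ ℂ) := by
  refine ⟨?_, ?_⟩
  · have : ((extChartAt 𝓘(ℝ, ℂ) p) : ConjPlane → ℂ) = (σ p) ∘ val := funext (extChartAt_apply p)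
    rw [this]
    exact ((σ p).continuous.comp continuous_val).continuousAt
  · have : writtenInExtChartAt 𝓘(ℝ, ℂ) 𝓘(ℝ, ℂ) p (extChartAt 𝓘(ℝ, ℂ) p) = id := by
      funext w
      simp [writtenInExtChartAt]
    rw [this]
    exact (hasFDerivAt_id _).hasFDerivWithinAt

/-- `mfderiv` of the extended chart at its centre is the identity. [folklore] -/
theorem mfderiv_extChartAt (p : ConjPlane) :
    mfderiv 𝓘(ℝ, ℂ) 𝓘(ℝ, ℂ) (extChartAt 𝓘(ℝ, ℂ) p) p = ContinuousLinearMap.id ℝ ℂ :=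
  (hasMFDerivAt_extChartAt p).mfderiv

variable {F : Type*} [NormedAddCommGroup F] [NormedSpace ℝ F] {k : ℕ}

/-- The chart representative of a form on the conj-atlas plane: the value at the image point `q`,
pulled back along the transition derivative `σ_q ∘ σ_p`. [folklore] -/
theorem inChart_apply_eq (α : Literature.Geometry.Kaehler.MForm 𝓘(ℝ, ℂ) ConjPlane F k)
    (p : ConjPlane) (y : ℂ) (v : Fin k → ℂ) :
    α.inChart p y v = α ((extChartAt 𝓘(ℝ, ℂ) p).symm y)
      (fun i ↦ σ ((extChartAt 𝓘(ℝ, ℂ) p).symm y) (σ p (v i))) := by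
  rw [Literature.Geometry.Kaehler.MForm.inChart_apply]
  simp only [mfderivWithin_extChartAt_symm]
  rfl

/-- The manifold exterior derivative on the conj-atlas plane is Mathlib's `extDeriv` of the chart
representative, at the chart image of the point. [folklore] -/
theorem mextDeriv_apply_eq (α : Literature.Geometry.Kaehler.MForm 𝓘(ℝ, ℂ) ConjPlane F k)
    (p : ConjPlane) (v : Fin (k + 1) → ℂ) :
    Literature.Geometry.Kaehler.mextDeriv α p v = extDeriv (α.inChart p) (σ p (val p)) v := by
  simp only [Literature.Geometry.Kaehler.mextDeriv, mfderiv_extChartAt,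
    ContinuousAlternatingMap.compContinuousLinearMap_apply,
    modelWithCornersSelf_coe, range_id, extDerivWithin_univ, extChartAt_apply]
  rfl

/-! ### Model forms on `ℂ = ℝ²` -/

/-- `dx` (real valued). [folklore] -/
def DX : ℂ [⋀^Fin 1]→L[ℝ] ℝ := ContinuousAlternatingMap.ofSubsingleton ℝ ℂ ℝ (0 : Fin 1) Complex.reCLM
/-- `dy` (real valued). [folklore] -/
def DY : ℂ [⋀^Fin 1]→L[ℝ] ℝ := ContinuousAlternatingMap.ofSubsingleton ℝ ℂ ℝ (0 : Fin 1) Complex.imCLM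
/-- `dx ⊗ 1` (complex valued). [folklore] -/
def DXc : ℂ [⋀^Fin 1]→L[ℝ] ℂ :=
  ContinuousAlternatingMap.ofSubsingleton ℝ ℂ ℂ (0 : Fin 1) (Complex.ofRealCLM.comp Complex.reCLM)
/-- `dy ⊗ 1` (complex valued). [folklore] -/
def DYc : ℂ [⋀^Fin 1]→L[ℝ] ℂ :=
  ContinuousAlternatingMap.ofSubsingleton ℝ ℂ ℂ (0 : Fin 1) (Complex.ofRealCLM.comp Complex.imCLM)
/-- `dz = dx + i dy`. [folklore] -/
def DZ : ℂ [⋀^Fin 1]→L[ℝ] ℂ :=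
  ContinuousAlternatingMap.ofSubsingleton ℝ ℂ ℂ (0 : Fin 1) (ContinuousLinearMap.id ℝ ℂ)
/-- `dz̄ = dx - i dy`. [folklore] -/
def DZBAR : ℂ [⋀^Fin 1]→L[ℝ] ℂ :=
  ContinuousAlternatingMap.ofSubsingleton ℝ ℂ ℂ (0 : Fin 1) Complex.conjCLE.toContinuousLinearMap

/-- `dx (v) = re v`. [folklore] -/
@[simp] theorem DX_apply (v : Fin 1 → ℂ) : DX v = (v 0).re := rfl
/-- `dy (v) = im v`. [folklore] -/
@[simp] theorem DY_apply (v : Fin 1 → ℂ) : DY v = (v 0).im := rfl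
/-- `(dx ⊗ 1)(v) = re v`. [folklore] -/
@[simp] theorem DXc_apply (v : Fin 1 → ℂ) : DXc v = ((v 0).re : ℂ) := rfl
/-- `(dy ⊗ 1)(v) = im v`. [folklore] -/
@[simp] theorem DYc_apply (v : Fin 1 → ℂ) : DYc v = ((v 0).im : ℂ) := rfl
/-- `dz (v) = v`. [folklore] -/
@[simp] theorem DZ_apply (v : Fin 1 → ℂ) : DZ v = v 0 := rfl
/-- `dz̄ (v) = v̄`. [folklore] -/
@[simp] theorem DZBAR_apply (v : Fin 1 → ℂ) : DZBAR v = conj (v 0) := rfl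

/-! ### The Hodge star on `1`-forms of the conj-atlas plane -/

/-- The unit vector `1` of the tangent space at `p`. [folklore] -/
def u1 (p : ConjPlane) : T p := (1 : ℂ)
/-- The unit vector `i` of the tangent space at `p`. [folklore] -/
def uI (p : ConjPlane) : T p := Complex.I

/-- `re 1 = 1` in the tangent space. [folklore] -/
@[simp] theorem re_u1 (p : ConjPlane) : Complex.re (u1 p) = 1 := rfl
/-- `im 1 = 0` in the tangent space. [folklore] -/
@[simp] theorem im_u1 (p : ConjPlane) : Complex.im (u1 p) = 0 := rfl
/-- `re i = 0` in the tangent space. [folklore] -/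
@[simp] theorem re_uI (p : ConjPlane) : Complex.re (uI p) = 0 := rfl
/-- `im i = 1` in the tangent space. [folklore] -/
@[simp] theorem im_uI (p : ConjPlane) : Complex.im (uI p) = 1 := rfl
/-- `re 1 = 1` (continuous-linear-map form). [folklore] -/
@[simp] theorem reCLM_u1 (p : ConjPlane) : Complex.reCLM (u1 p) = 1 := rfl
/-- `im 1 = 0` (continuous-linear-map form). [folklore] -/
@[simp] theorem imCLM_u1 (p : ConjPlane) : Complex.imCLM (u1 p) = 0 := rfl
/-- `re i = 0` (continuous-linear-map form). [folklore] -/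
@[simp] theorem reCLM_uI (p : ConjPlane) : Complex.reCLM (uI p) = 0 := rfl
/-- `im i = 1` (continuous-linear-map form). [folklore] -/
@[simp] theorem imCLM_uI (p : ConjPlane) : Complex.imCLM (uI p) = 1 := rfl

/-- Coordinate decomposition of a tangent vector. [folklore] -/
theorem eq_smul_u1_add_smul_uI (p : ConjPlane) (w : T p) :
    w = (Complex.re w) • u1 p + (Complex.im w) • uI p := by
  refine Complex.ext ?_ ?_
  · change Complex.re w = Complex.re (((Complex.re w : ℝ) • (1 : ℂ)) + ((Complex.im w : ℝ) • Complex.I))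
    simp
  · change Complex.im w = Complex.im (((Complex.re w : ℝ) • (1 : ℂ)) + ((Complex.im w : ℝ) • Complex.I))
    simp

/-- The Riesz vector of a covector `ℓ` for the flat metric: `ℓ(1) + ℓ(i) i`. [folklore] -/
def riesz (p : ConjPlane) (ℓ : T p →L[ℝ] ℝ) : T p := ((ℓ (u1 p) : ℂ) + (ℓ (uI p) : ℂ) * Complex.I : ℂ)

/-- The real part of the Riesz vector is `ℓ(1)`. [folklore] -/
@[simp] theorem re_riesz (p : ConjPlane) (ℓ : T p →L[ℝ] ℝ) : Complex.re (riesz p ℓ) = ℓ (u1 p) := by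
  simp [riesz]
/-- The imaginary part of the Riesz vector is `ℓ(i)`. [folklore] -/
@[simp] theorem im_riesz (p : ConjPlane) (ℓ : T p →L[ℝ] ℝ) : Complex.im (riesz p ℓ) = ℓ (uI p) := by
  simp [riesz]

/-- `riesz p ℓ` represents `ℓ`: `⟪riesz ℓ, ·⟫ = ℓ`. [folklore] -/
theorem innerSL_riesz (p : ConjPlane) (ℓ : T p →L[ℝ] ℝ) : innerSL ℝ (riesz p ℓ) = ℓ := by
  ext w
  rw [innerSL_apply_apply, inner_eq, flatInner_apply, re_riesz, im_riesz]
  conv_rhs => rw [eq_smul_u1_add_smul_uI p w]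
  rw [map_add, map_smul, map_smul, smul_eq_mul, smul_eq_mul]
  ring

/-- The Hodge star of the flat metric on `1`-forms, for the orientation family `orient`:
`⋆(ℓ₁ dx + ℓ₂ dy) = ε (ℓ₁ dy - ℓ₂ dx)` (`ε = ±1` the sign of the chart). [folklore] -/
theorem hodgeStar_ofSubsingleton_apply (p : ConjPlane) (h : 1 + 1 = 2) (ℓ : T p →L[ℝ] ℝ) (w : T p) :
    Literature.Geometry.Kaehler.hodgeStar (orient p) h
        (ContinuousAlternatingMap.ofSubsingleton ℝ (T p) ℝ (0 : Fin 1) ℓ) ![w] =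
      ε p * (ℓ (u1 p) * Complex.im w - ℓ (uI p) * Complex.re w) := by
  rw [← innerSL_riesz p ℓ, Literature.Geometry.Kaehler.hodgeStar_apply_eq_areaForm_holds (orient p) h,
    Orientation.areaForm_to_volumeForm, volumeForm_apply, innerSL_riesz, re_riesz, im_riesz]

/-- On the tangent space at `p`, `dx = ⟪1, ·⟫`. [folklore] -/
theorem DX_eq (p : ConjPlane) : (DX : T p [⋀^Fin 1]→L[ℝ] ℝ) =
    ContinuousAlternatingMap.ofSubsingleton ℝ (T p) ℝ (0 : Fin 1) (innerSL ℝ (u1 p)) := by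
  ext w
  change Complex.re (w 0) = inner ℝ (u1 p) (w 0)
  rw [inner_eq, flatInner_apply, re_u1, im_u1]
  ring

/-- On the tangent space at `p`, `dy = ⟪i, ·⟫`. [folklore] -/
theorem DY_eq (p : ConjPlane) : (DY : T p [⋀^Fin 1]→L[ℝ] ℝ) =
    ContinuousAlternatingMap.ofSubsingleton ℝ (T p) ℝ (0 : Fin 1) (innerSL ℝ (uI p)) := by
  ext w
  change Complex.im (w 0) = inner ℝ (uI p) (w 0)
  rw [inner_eq, flatInner_apply, re_uI, im_uI]
  ring

/-- `⋆dx = ε dy`. [folklore] -/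
theorem hodgeStar_DX (p : ConjPlane) (h : 1 + 1 = 2) (w : Fin 1 → T p) :
    Literature.Geometry.Kaehler.hodgeStar (orient p) h (DX : T p [⋀^Fin 1]→L[ℝ] ℝ) w =
      ε p * Complex.im (w 0) := by
  have hw : w = ![w 0] := by
    funext i
    fin_cases i
    rfl
  rw [hw, DX_eq, Literature.Geometry.Kaehler.hodgeStar_apply_eq_areaForm_holds (orient p) h,
    Orientation.areaForm_to_volumeForm, volumeForm_apply, re_u1, im_u1]
  simp

/-- `⋆dy = -ε dx`. [folklore] -/
theorem hodgeStar_DY (p : ConjPlane) (h : 1 + 1 = 2) (w : Fin 1 → T p) :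
    Literature.Geometry.Kaehler.hodgeStar (orient p) h (DY : T p [⋀^Fin 1]→L[ℝ] ℝ) w =
      -(ε p * Complex.re (w 0)) := by
  have hw : w = ![w 0] := by
    funext i
    fin_cases i
    rfl
  rw [hw, DY_eq, Literature.Geometry.Kaehler.hodgeStar_apply_eq_areaForm_holds (orient p) h,
    Orientation.areaForm_to_volumeForm, volumeForm_apply, re_uI, im_uI]
  simp

/-! ### The test function `f = (re z)²` and its derivative -/

/-- The real function `(re y)²` with complex values. [folklore] -/
def fsq (y : ℂ) : ℂ := ((y.re ^ 2 : ℝ) : ℂ)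

/-- `D((re y)²) = 2 (re y) re`. [folklore] -/
theorem hasFDerivAt_fsq (y : ℂ) :
    HasFDerivAt fsq ((2 * y.re) • Complex.ofRealCLM.comp Complex.reCLM) y := by
  have h1 := (Complex.reCLM.hasFDerivAt (x := y)).pow 2
  have h2 := Complex.ofRealCLM.hasFDerivAt.comp y h1
  have hf : fsq = (⇑Complex.ofRealCLM) ∘ (fun x : ℂ ↦ Complex.reCLM x ^ 2) := by
    funext x
    simp [fsq]
  rw [hf]
  refine h2.congr_fderiv ?_
  ext1 v
  simp

/-- `D((re y)²) = 2 (re y) re` (`fderiv` form). [folklore] -/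
theorem fderiv_fsq (y : ℂ) : fderiv ℝ fsq y = (2 * y.re) • Complex.ofRealCLM.comp Complex.reCLM :=
  (hasFDerivAt_fsq y).fderiv

/-- `(re y)²` is smooth. [folklore] -/
theorem contDiff_fsq : ContDiff ℝ ∞ fsq :=
  Complex.ofRealCLM.contDiff.comp (Complex.reCLM.contDiff.pow 2)

/-- The smooth `0`-form `f = (re z)²` on the conj-atlas plane (well defined: `re (conj z) = re z`). [folklore] -/
def f0 : Literature.Geometry.Kaehler.MForm 𝓘(ℝ, ℂ) ConjPlane ℂ 0 :=
  fun p ↦ ContinuousAlternatingMap.constOfIsEmpty ℝ (T p) (Fin 0) (fsq (val p))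

/-- The chart representative of `f` at any point is `y ↦ (re y)²`. [folklore] -/
theorem inChart_f0 (p : ConjPlane) :
    f0.inChart p = fun y ↦ ContinuousAlternatingMap.constOfIsEmpty ℝ ℂ (Fin 0) (fsq y) := by
  funext y
  ext v
  rw [inChart_apply_eq]
  simp [f0, fsq]

/-- `f` is a smooth `0`-form. [folklore] -/
theorem isSmoothForm_f0 : Literature.Geometry.Kaehler.IsSmoothForm f0 := by
  intro p
  rw [inChart_f0]
  exact ((ContinuousAlternatingMap.constOfIsEmptyLIE ℝ ℂ ℂ (Fin 0)).contDiff.comp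
    contDiff_fsq).contDiffAt.contDiffWithinAt

/-- `df = 2x dx` on the conj-atlas plane (in every chart). [folklore] -/
def η : Literature.Geometry.Kaehler.MForm 𝓘(ℝ, ℂ) ConjPlane ℂ 1 :=
  fun p ↦ ((2 * (val p).re) • DXc : ℂ [⋀^Fin 1]→L[ℝ] ℂ)

/-- `(2x dx)(v) = 2x re v`. [folklore] -/
theorem η_apply (p : ConjPlane) (v : Fin 1 → T p) :
    η p v = ((2 * (val p).re : ℝ) : ℂ) * (Complex.re (v 0) : ℂ) := by
  change (2 * (val p).re) • ((Complex.re (v 0) : ℝ) : ℂ) = _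
  rw [Complex.real_smul]

/-- `d f = 2x dx`. [folklore] -/
theorem mextDeriv_f0 : Literature.Geometry.Kaehler.mextDeriv f0 = η := by
  funext p
  ext v
  rw [mextDeriv_apply_eq, inChart_f0, extDeriv_constOfIsEmpty, fderiv_fsq, η_apply]
  simp

/-! ### Type decomposition of `df`: `∂f = x dz`, `∂̄f = x dz̄` -/

/-- `∂f = x dz`. [folklore] -/
def η10 : Literature.Geometry.Kaehler.MForm 𝓘(ℝ, ℂ) ConjPlane ℂ 1 :=
  fun p ↦ ((((val p).re : ℝ) : ℂ) • DZ : ℂ [⋀^Fin 1]→L[ℝ] ℂ)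

/-- `∂̄f = x dz̄` (in every chart). [folklore] -/
def η01 : Literature.Geometry.Kaehler.MForm 𝓘(ℝ, ℂ) ConjPlane ℂ 1 :=
  fun p ↦ ((((val p).re : ℝ) : ℂ) • DZBAR : ℂ [⋀^Fin 1]→L[ℝ] ℂ)

/-- `(x dz)(v) = x v`. [folklore] -/
theorem η10_apply (p : ConjPlane) (v : Fin 1 → T p) :
    η10 p v = ((val p).re : ℂ) * (show ℂ from v 0) := rfl

/-- `(x dz̄)(v) = x v̄`. [folklore] -/
theorem η01_apply (p : ConjPlane) (v : Fin 1 → T p) :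
    η01 p v = ((val p).re : ℂ) * conj (show ℂ from v 0) := rfl

/-- `df = ∂f + ∂̄f`. [folklore] -/
theorem η_eq_add : η = η10 + η01 := by
  funext p
  ext v
  rw [Pi.add_apply, ContinuousAlternatingMap.add_apply, η_apply, η10_apply, η01_apply, ← mul_add,
    Complex.add_conj]
  push_cast
  ring

/-- `x dz` has type `(1,0)`. [folklore] -/
theorem isOfType_η10 : IsOfType 1 0 η10 := by
  refine ⟨rfl, fun x θ v ↦ ?_⟩
  rw [η10_apply, η10_apply]
  change ((val x).re : ℂ) * (Complex.exp (θ * Complex.I) * (show ℂ from v 0)) = _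
  push_cast
  ring

/-- `x dz̄` has type `(0,1)`. [folklore] -/
theorem isOfType_η01 : IsOfType 0 1 η01 := by
  refine ⟨rfl, fun x θ v ↦ ?_⟩
  rw [η01_apply, η01_apply]
  change ((val x).re : ℂ) * conj (Complex.exp (θ * Complex.I) * (show ℂ from v 0)) = _
  rw [map_mul, ← Complex.exp_conj, map_mul, Complex.conj_ofReal, Complex.conj_I]
  have : Complex.exp (↑θ * -Complex.I) = Complex.exp ((((0 : ℕ) : ℤ) - ((1 : ℕ) : ℤ) : ℤ) * θ * Complex.I) := by
    congr 1
    push_cast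
    ring
  rw [this]
  ring

/-- `f` has type `(0,0)`. [folklore] -/
theorem isOfType_f0 : IsOfType 0 0 f0 := by
  refine ⟨rfl, fun x θ v ↦ ?_⟩
  have hv : (fun i ↦ tangentRotate ℂ x θ (v i)) = v := funext (fun i ↦ Fin.elim0 i)
  rw [hv]
  simp

/-- `f^{0,0} = f`. [folklore] -/
theorem typeComponent_f0 : f0.typeComponent 0 0 = f0 := isOfType_f0.typeComponent_eq_self

/-- `(df)^{0,1} = x dz̄`. [folklore] -/
theorem typeComponent_η : η.typeComponent 0 1 = η01 := by
  rw [η_eq_add, Literature.Geometry.Kaehler.MForm.typeComponent_add,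
    IsOfType.typeComponent_of_ne_holds isOfType_η10 (Or.inl one_ne_zero),
    isOfType_η01.typeComponent_eq_self, zero_add]

/-- `∂̄f = x dz̄` (the Dolbeault operator of C10 applied to `f`). [folklore] -/
theorem dolbeaultBar_f0 : dolbeaultBar f0 = η01 := by
  simp only [dolbeaultBar, Finset.Nat.antidiagonal_zero, Finset.sum_singleton]
  rw [typeComponent_f0, mextDeriv_f0, typeComponent_η]

/-! ### `⋆ ∂̄f` and `⋆ df` -/

/-- `⋆∂̄f = ± i x dz̄` (sign `ε`: the Hodge star follows the orientation family, which is
reversed below the real axis). [folklore] -/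
def β : Literature.Geometry.Kaehler.MForm 𝓘(ℝ, ℂ) ConjPlane ℂ 1 :=
  fun p ↦ ((Complex.I * (val p).re * ε p : ℂ) • DZBAR : ℂ [⋀^Fin 1]→L[ℝ] ℂ)

/-- `(± i x dz̄)(v) = i x ε v̄`. [folklore] -/
theorem β_apply (p : ConjPlane) (v : Fin 1 → T p) :
    β p v = Complex.I * (val p).re * ε p * conj (show ℂ from v 0) := rfl

/-- `⋆ df = ± 2x dy`. [folklore] -/
def γ : Literature.Geometry.Kaehler.MForm 𝓘(ℝ, ℂ) ConjPlane ℂ 1 :=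
  fun p ↦ (((2 * (val p).re * ε p : ℝ) : ℂ) • DYc : ℂ [⋀^Fin 1]→L[ℝ] ℂ)

/-- `(± 2x dy)(v) = 2 x ε im v`. [folklore] -/
theorem γ_apply (p : ConjPlane) (v : Fin 1 → T p) :
    γ p v = ((2 * (val p).re * ε p : ℝ) : ℂ) * (Complex.im (v 0) : ℂ) := rfl

/-- `Re (x dz̄) = x dx`. [folklore] -/
theorem re_η01 (p : ConjPlane) : η01.re p = (val p).re • (DX : T p [⋀^Fin 1]→L[ℝ] ℝ) := by
  ext w
  change Complex.re (((val p).re : ℂ) * conj (show ℂ from w 0)) = (val p).re • Complex.re (w 0)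
  simp

/-- `Im (x dz̄) = -x dy`. [folklore] -/
theorem im_η01 (p : ConjPlane) : η01.im p = (-(val p).re) • (DY : T p [⋀^Fin 1]→L[ℝ] ℝ) := by
  ext w
  change Complex.im (((val p).re : ℂ) * conj (show ℂ from w 0)) = (-(val p).re) • Complex.im (w 0)
  simp

/-- `Re (2x dx ⊗ 1) = 2x dx`. [folklore] -/
theorem re_η (p : ConjPlane) : η.re p = (2 * (val p).re) • (DX : T p [⋀^Fin 1]→L[ℝ] ℝ) := by
  ext w
  change Complex.re (η p w) = (2 * (val p).re) • Complex.re (w 0)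
  rw [η_apply]
  simp

/-- `Im (2x dx ⊗ 1) = 0`. [folklore] -/
theorem im_η (p : ConjPlane) : η.im p = 0 := by
  ext w
  change Complex.im (η p w) = 0
  rw [η_apply]
  simp

/-- `⋆ ∂̄f = ± i x dz̄`. [folklore] -/
theorem cHodgeStar_η01 (h : 0 + 1 + 1 = 2) :
    Literature.Geometry.Kaehler.MForm.cHodgeStar orient h η01 = β := by
  funext p
  ext v
  rw [Literature.Geometry.Kaehler.MForm.cHodgeStar_apply, Pi.add_apply, Pi.smul_apply,
    ContinuousAlternatingMap.add_apply, ContinuousAlternatingMap.smul_apply,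
    Literature.Geometry.Kaehler.MForm.ofReal_apply, Literature.Geometry.Kaehler.MForm.ofReal_apply,
    Literature.Geometry.Kaehler.MForm.hodgeStar_apply, Literature.Geometry.Kaehler.MForm.hodgeStar_apply,
    re_η01, im_η01, map_smul, map_smul, ContinuousAlternatingMap.smul_apply,
    ContinuousAlternatingMap.smul_apply, hodgeStar_DX, hodgeStar_DY, β_apply]
  apply Complex.ext
  · simp
    ring
  · simp
    ring

/-- `⋆ df = ± 2x dy`. [folklore] -/
theorem cHodgeStar_η (h : 0 + 1 + 1 = 2) :
    Literature.Geometry.Kaehler.MForm.cHodgeStar orient h η = γ := by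
  funext p
  ext v
  rw [Literature.Geometry.Kaehler.MForm.cHodgeStar_apply, Pi.add_apply, Pi.smul_apply,
    ContinuousAlternatingMap.add_apply, ContinuousAlternatingMap.smul_apply,
    Literature.Geometry.Kaehler.MForm.ofReal_apply, Literature.Geometry.Kaehler.MForm.ofReal_apply,
    Literature.Geometry.Kaehler.MForm.hodgeStar_apply, Literature.Geometry.Kaehler.MForm.hodgeStar_apply,
    re_η, im_η, map_smul, map_zero, ContinuousAlternatingMap.smul_apply,
    ContinuousAlternatingMap.coe_zero, Pi.zero_apply, hodgeStar_DX, γ_apply]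
  apply Complex.ext
  · simp
    ring
  · simp

/-! ### The volume form is the genuine `dx ∧ dy`, hence smooth -/

/-- `dx ∧ dy` (real valued, in the model space): the alternatisation of `h ↦ (re h) • dy`. [folklore] -/
def Ωr : ℂ [⋀^Fin (1 + 1)]→L[ℝ] ℝ :=
  ContinuousAlternatingMap.alternatizeUncurryFin (Complex.reCLM.smulRight DY)

/-- `(dx ∧ dy)(v, w) = v₁ w₂ - v₂ w₁`. [folklore] -/
theorem Ωr_apply (v : Fin 2 → ℂ) : Ωr v = (v 0).re * (v 1).im - (v 0).im * (v 1).re := by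
  simp [Ωr, ContinuousAlternatingMap.alternatizeUncurryFin_apply, Fin.sum_univ_two, Fin.removeNth]
  ring

/-- `dx ∧ dy ≠ 0`. [folklore] -/
theorem Ωr_ne_zero : Ωr ≠ 0 := fun h ↦ by
  simpa [h] using Ωr_apply ![(1 : ℂ), Complex.I]

/-- The volume form at `q` on a general `2`-tuple. [folklore] -/
theorem volumeForm_apply' (q : ConjPlane) (u : Fin 2 → T q) :
    (orient q).volumeForm u =
      ε q * (Complex.re (u 0) * Complex.im (u 1) - Complex.im (u 0) * Complex.re (u 1)) := by
  have hu : u = ![u 0, u 1] := by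
    funext i
    fin_cases i <;> rfl
  rw [hu, volumeForm_apply]
  rfl

/-- The chart representative of the Riemannian volume form at any point is the constant
`± dx ∧ dy`. [folklore] -/
theorem inChart_riemannianVolumeForm (p : ConjPlane) (y : ℂ) :
    (Literature.Geometry.Kaehler.riemannianVolumeForm orient).inChart p y = (ε p) • Ωr := by
  ext v
  rw [inChart_apply_eq, Literature.Geometry.Kaehler.riemannianVolumeForm_apply,
    Orientation.volumeFormL_apply, volumeForm_apply', ContinuousAlternatingMap.smul_apply, Ωr_apply,
    smul_eq_mul]
  simp only [re_σ, im_σ]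
  linear_combination (ε p * ((v 0).re * (v 1).im - (v 0).im * (v 1).re)) *
    ε_mul_ε ((extChartAt 𝓘(ℝ, ℂ) p).symm y)

/-- The hypothesis `ho` of the fact holds: the Riemannian volume form of the flat metric for the
orientation family `orient` is smooth (it is the genuine `dx ∧ dy`). [folklore] -/
theorem isSmoothForm_riemannianVolumeForm :
    Literature.Geometry.Kaehler.IsSmoothForm (Literature.Geometry.Kaehler.riemannianVolumeForm orient) := by
  intro p
  have : (Literature.Geometry.Kaehler.riemannianVolumeForm orient).inChart p = fun _ ↦ (ε p) • Ωr :=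
    funext (inChart_riemannianVolumeForm p)
  rw [this]
  exact contDiffWithinAt_const

/-! ### `∂(⋆∂̄f)` at the point `1`: a junk zero -/

/-- `⋆∂̄f` has type `(0,1)`. [folklore] -/
theorem isOfType_β : IsOfType 0 1 β := by
  refine ⟨rfl, fun x θ v ↦ ?_⟩
  rw [β_apply, β_apply]
  change Complex.I * (val x).re * ε x * conj (Complex.exp (θ * Complex.I) * (show ℂ from v 0)) = _
  rw [map_mul, ← Complex.exp_conj, map_mul, Complex.conj_ofReal, Complex.conj_I]
  have : Complex.exp (↑θ * -Complex.I) =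
      Complex.exp ((((0 : ℕ) : ℤ) - ((1 : ℕ) : ℤ) : ℤ) * θ * Complex.I) := by
    congr 1
    push_cast
    ring
  rw [this]
  ring

/-- `∂(⋆∂̄f) = (d ⋆∂̄f)^{1,1}` (the `(1,0)`-component of `⋆∂̄f` vanishes). [folklore] -/
theorem dolbeault_β : dolbeault β = (Literature.Geometry.Kaehler.mextDeriv β).typeComponent 1 1 := by
  simp only [dolbeault, Finset.Nat.sum_antidiagonal_succ, Finset.Nat.antidiagonal_zero,
    Finset.sum_singleton, zero_add]
  rw [isOfType_β.typeComponent_eq_self,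
    IsOfType.typeComponent_of_ne_holds isOfType_β (Or.inl zero_ne_one),
    Literature.Geometry.Kaehler.mextDeriv_zero, Literature.Geometry.Kaehler.MForm.typeComponent_zero,
    add_zero]

/-- The base point `1` (on the real axis: it carries the identity chart, and every neighbourhood
of it meets the open lower half plane, which carries the conjugation chart). [folklore] -/
def c1 : ConjPlane := mk 1

/-- The point `1` lies on the closed upper half plane (it carries the identity chart). [folklore] -/
theorem up_c1 : up c1 := le_of_eq (by simp : (0 : ℝ) = (val (mk 1)).im)

/-- The underlying complex number of the base point is `1`. [folklore] -/
@[simp] theorem val_c1 : val c1 = 1 := rfl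
/-- The frame map at the base point is the identity. [folklore] -/
@[simp] theorem σ_c1 : σ c1 = ContinuousLinearMap.id ℝ ℂ := σ_of_up up_c1
/-- The sign at the base point is `+1`. [folklore] -/
@[simp] theorem ε_c1 : ε c1 = 1 := ε_of_up up_c1

/-- `mk y` lies in the closed upper half plane iff `0 ≤ im y`. [folklore] -/
theorem up_mk_iff (y : ℂ) : up (mk y) ↔ 0 ≤ y.im := Iff.rfl

/-- The chart representative of `⋆∂̄f` at `1`, on the vector `w`: `i (re y) ε_y conj (σ_y w)`, i.e.
`i (re y) conj w · dz̄`-like above the real axis and `-i (re y) w` below. [folklore] -/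
theorem inChart_β_c1_apply (y w : ℂ) :
    β.inChart c1 y ![w] = Complex.I * y.re * ε (mk y) * conj (σ (mk y) w) := by
  rw [inChart_apply_eq, β_apply]
  simp only [extChartAt_symm_apply, σ_c1, ContinuousLinearMap.id_apply, val_mk,
    Matrix.cons_val_zero]

/-- Above the real axis (and on it) the representative is `i (re y) conj w`. [folklore] -/
theorem inChart_β_c1_apply_of_nonneg {y : ℂ} (hy : 0 ≤ y.im) (w : ℂ) :
    β.inChart c1 y ![w] = Complex.I * y.re * conj w := by
  rw [inChart_β_c1_apply, ε_of_up ((up_mk_iff y).2 hy), σ_of_up ((up_mk_iff y).2 hy)]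
  simp

/-- Below the real axis the representative is `-i (re y) w`. [folklore] -/
theorem inChart_β_c1_apply_of_neg {y : ℂ} (hy : y.im < 0) (w : ℂ) :
    β.inChart c1 y ![w] = -(Complex.I * y.re * w) := by
  have h : ¬ up (mk y) := fun h ↦ absurd ((up_mk_iff y).1 h) (not_le.2 hy)
  rw [inChart_β_c1_apply, ε_of_not_up h, σ_of_not_up h]
  simp

/-- The chart representative of `⋆∂̄f` at `1` is **not differentiable** (not even continuous) at
`1`: along `1 - ti`, `t ↓ 0`, its value on the vector `1` is constantly `-i`, but at `1` it is `i`. [folklore] -/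
theorem not_differentiableAt_inChart_β : ¬ DifferentiableAt ℝ (β.inChart c1) 1 := by
  intro hd
  have hc : ContinuousAt (fun y ↦ β.inChart c1 y ![(1 : ℂ)]) 1 :=
    ((ContinuousAlternatingMap.apply ℝ ℂ ℂ ![(1 : ℂ)]).continuous.continuousAt).comp hd.continuousAt
  have hp : Tendsto (fun t : ℝ ↦ (1 : ℂ) - t * Complex.I) (𝓝[>] 0) (𝓝 1) := by
    have : Continuous (fun t : ℝ ↦ (1 : ℂ) - t * Complex.I) := by fun_prop
    simpa using (this.tendsto 0).mono_left nhdsWithin_le_nhds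
  have h1 : Tendsto (fun t : ℝ ↦ β.inChart c1 ((1 : ℂ) - t * Complex.I) ![(1 : ℂ)]) (𝓝[>] 0)
      (𝓝 (β.inChart c1 1 ![(1 : ℂ)])) :=
    hc.tendsto.comp hp
  have h2 : Tendsto (fun t : ℝ ↦ β.inChart c1 ((1 : ℂ) - t * Complex.I) ![(1 : ℂ)]) (𝓝[>] 0)
      (𝓝 (-Complex.I)) := by
    refine tendsto_const_nhds.congr' ?_
    filter_upwards [self_mem_nhdsWithin] with t (ht : 0 < t)
    rw [inChart_β_c1_apply_of_neg (by simpa using ht)]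
    simp
  have h3 : β.inChart c1 1 ![(1 : ℂ)] = Complex.I := by
    rw [inChart_β_c1_apply_of_nonneg (by simp)]
    simp
  have h4 := tendsto_nhds_unique h1 h2
  rw [h3] at h4
  have h5 : (2 : ℂ) * Complex.I = 0 := by linear_combination h4
  simp at h5

/-- **Junk zero:** `d(⋆∂̄f)` vanishes at `1` (Mathlib's `fderiv` of a non-differentiable map is `0`). [folklore] -/
theorem mextDeriv_β_c1 : Literature.Geometry.Kaehler.mextDeriv β c1 = 0 := by
  have key : extDeriv (β.inChart c1) 1 = 0 := by
    change ContinuousAlternatingMap.alternatizeUncurryFin (fderiv ℝ (β.inChart c1) 1) = 0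
    rw [fderiv_zero_of_not_differentiableAt not_differentiableAt_inChart_β]
    ext v
    simp [ContinuousAlternatingMap.alternatizeUncurryFin_apply]
  ext v
  rw [mextDeriv_apply_eq, σ_c1, val_c1, ContinuousLinearMap.id_apply, key]
  rfl

/-- Type components are taken pointwise: a form vanishing at `x` has all its components vanishing
at `x`. [folklore] -/
theorem typeComponent_apply_eq_zero {k : ℕ} {α : Literature.Geometry.Kaehler.MForm 𝓘(ℝ, ℂ) ConjPlane ℂ k}
    {x : ConjPlane} (hx : α x = 0) (p q : ℕ) : α.typeComponent p q x = 0 := by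
  have h0 : ∀ g : T x →L[ℝ] T x, (0 : T x [⋀^Fin k]→L[ℝ] ℂ).compContinuousLinearMap g = 0 :=
    fun g ↦ by ext; simp
  unfold Literature.Geometry.Kaehler.MForm.typeComponent Literature.Geometry.Kaehler.MForm.weightComponent
  split_ifs
  · simp [hx, h0]
  · rfl

/-- `∂(⋆∂̄f)(1) = 0`. [folklore] -/
theorem dolbeault_β_c1 : dolbeault β c1 = 0 := by
  rw [dolbeault_β]
  exact typeComponent_apply_eq_zero mextDeriv_β_c1 1 1

/-- The `ℂ`-linear Hodge star is pointwise: it kills a form at any point where the form vanishes. [folklore] -/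
theorem cHodgeStar_apply_eq_zero {k m : ℕ} {α : Literature.Geometry.Kaehler.MForm 𝓘(ℝ, ℂ) ConjPlane ℂ k}
    {x : ConjPlane} (hx : α x = 0) (h : k + m = 2) :
    Literature.Geometry.Kaehler.MForm.cHodgeStar orient h α x = 0 := by
  have hre : α.re x = 0 := by
    ext v
    rw [Literature.Geometry.Kaehler.MForm.re_apply, hx]
    rfl
  have him : α.im x = 0 := by
    ext v
    rw [Literature.Geometry.Kaehler.MForm.im_apply, hx]
    rfl
  ext v
  rw [Literature.Geometry.Kaehler.MForm.cHodgeStar_apply, Pi.add_apply, Pi.smul_apply,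
    ContinuousAlternatingMap.add_apply, ContinuousAlternatingMap.smul_apply,
    Literature.Geometry.Kaehler.MForm.ofReal_apply, Literature.Geometry.Kaehler.MForm.ofReal_apply,
    Literature.Geometry.Kaehler.MForm.hodgeStar_apply, Literature.Geometry.Kaehler.MForm.hodgeStar_apply,
    hre, him, map_zero]
  simp

/-- **`2Δ_∂̄ f (1) = 0`**: `Δ_∂̄ f = ∂̄*∂̄f = -⋆∂⋆∂̄f`, and `∂(⋆∂̄f)(1)` is the junk zero. [folklore] -/
theorem two_smul_dolbeaultLaplacian_f0_c1 (h : 0 + 2 = 2) :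
    ((2 : ℂ) • dolbeaultLaplacian orient 0 2 h f0) c1 = 0 := by
  simp only [dolbeaultLaplacian, dolbeaultBarAdjoint, Pi.smul_apply, Pi.neg_apply]
  rw [dolbeaultBar_f0, cHodgeStar_η01, cHodgeStar_apply_eq_zero dolbeault_β_c1, neg_zero, smul_zero]

/-! ### `Δ_d f (1) ≠ 0`: the genuine Laplacian -/

/-- The chart representative of `⋆df` at `1` is the genuine smooth form `2x dy` (the orientation
flip below the axis is undone by the transition derivative `conj`). [folklore] -/
theorem inChart_γ_c1 : γ.inChart c1 = fun y ↦ ((2 * y.re) • DYc : ℂ [⋀^Fin 1]→L[ℝ] ℂ) := by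
  funext y
  ext v
  rw [inChart_apply_eq, γ_apply]
  simp only [extChartAt_symm_apply, σ_c1, ContinuousLinearMap.id_apply, val_mk, im_σ]
  change _ = (2 * y.re) • ((Complex.im (v 0) : ℝ) : ℂ)
  rw [Complex.real_smul, ← Complex.ofReal_mul, ← Complex.ofReal_mul]
  congr 1
  linear_combination (2 * y.re * Complex.im (v 0)) * ε_mul_ε (mk y)

/-- The derivative of `y ↦ 2 (re y) dy`. [folklore] -/
theorem hasFDerivAt_two_re_smul_DYc (y : ℂ) :
    HasFDerivAt (fun y : ℂ ↦ ((2 * y.re) • DYc : ℂ [⋀^Fin 1]→L[ℝ] ℂ))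
      (((2 : ℝ) • Complex.reCLM).smulRight DYc) y :=
  ((Complex.reCLM.hasFDerivAt (x := y)).const_mul 2).smul_const DYc

/-- `d (2x dy) = 2 dx ∧ dy` (real part; the form is real). [folklore] -/
theorem re_extDeriv_two_re_smul_DYc (v : Fin (1 + 1) → ℂ) :
    (extDeriv (fun y : ℂ ↦ ((2 * y.re) • DYc : ℂ [⋀^Fin 1]→L[ℝ] ℂ)) 1 v).re = ((2 : ℝ) • Ωr) v := by
  rw [extDeriv, (hasFDerivAt_two_re_smul_DYc 1).fderiv, ContinuousAlternatingMap.smul_apply, Ωr_apply]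
  simp [ContinuousAlternatingMap.alternatizeUncurryFin_apply, Fin.sum_univ_two, Fin.removeNth]
  ring

/-- `d ⋆ d f (1) = 2 dx ∧ dy` (real part; the form is real). [folklore] -/
theorem re_mextDeriv_γ_c1 :
    (Literature.Geometry.Kaehler.mextDeriv γ).re c1 = (2 : ℝ) • (Ωr : T c1 [⋀^Fin (1 + 1)]→L[ℝ] ℝ) := by
  ext v
  rw [Literature.Geometry.Kaehler.MForm.re_apply, mextDeriv_apply_eq, σ_c1, val_c1,
    ContinuousLinearMap.id_apply, inChart_γ_c1]
  exact re_extDeriv_two_re_smul_DYc v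

/-- **`Δ_d f (1) ≠ 0`**: `Δ_d f = δ d f = -⋆ d ⋆ d f` and `d ⋆ d f (1) = 2 dx ∧ dy ≠ 0`, the Hodge
star being injective. [folklore] -/
theorem cHodgeLaplacian_f0_c1_ne (h : 0 + 2 = 2) : cHodgeLaplacian orient 0 2 h f0 c1 ≠ 0 := by
  simp only [cHodgeLaplacian, cmcoderiv]
  rw [mextDeriv_f0, cHodgeStar_η, Pi.smul_apply]
  refine smul_ne_zero (pow_ne_zero _ (by norm_num)) ?_
  intro h0
  have h' : 1 + 1 + 0 = 2 := by norm_num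
  have h1 := congrFun (Literature.Geometry.Kaehler.MForm.re_cHodgeStar orient h'
    (Literature.Geometry.Kaehler.mextDeriv γ)) c1
  rw [Literature.Geometry.Kaehler.MForm.hodgeStar_apply, re_mextDeriv_γ_c1, map_smul] at h1
  have h2 : (Literature.Geometry.Kaehler.MForm.cHodgeStar orient h'
      (Literature.Geometry.Kaehler.mextDeriv γ)).re c1 = 0 := by
    ext v
    rw [Literature.Geometry.Kaehler.MForm.re_apply, h0]
    rfl
  rw [h2] at h1
  have h3 : Literature.Geometry.Kaehler.hodgeStar (orient c1) h' (Ωr : T c1 [⋀^Fin (1 + 1)]→L[ℝ] ℝ) = 0 := by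
    have h1' := h1.symm
    rw [smul_eq_zero] at h1'
    exact h1'.resolve_left two_ne_zero
  have hinj := Literature.Geometry.Kaehler.hodgeStar_injective_holds (orient c1) (k := 1 + 1) (m := 0) h'
  exact Ωr_ne_zero (hinj (h3.trans (map_zero _).symm))

/-- **The counterexample.** For the flat Kähler metric on the conj-atlas plane, the smooth `0`-form
`f = (re z)²` violates `Δ_d f = 2Δ_∂̄ f` (at the point `1`: `Δ_d f (1) ≠ 0 = 2Δ_∂̄ f (1)`). [folklore] -/
theorem cHodgeLaplacian_f0_ne (h : 0 + 2 = 2) :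
    cHodgeLaplacian orient 0 2 h f0 ≠ (2 : ℂ) • dolbeaultLaplacian orient 0 2 h f0 := fun H ↦
  cHodgeLaplacian_f0_c1_ne h (by rw [H]; exact two_smul_dolbeaultLaplacian_f0_c1 h)

/-- **The named fact `cHodgeLaplacian_eq_two_smul_dolbeaultLaplacian` fails on the conj-atlas
plane** (`E = ℂ`, `M = ConjPlane`, `n = 2`, degrees `k = 0`, `m = 2`, the smooth flat metric
`flatMetric`, the orientation family `orient` — an instance of the fact's own binders, which do not
include a holomorphic atlas): all its hypotheses hold (`IsKaehler`, smooth form, smooth volume form)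
but its conclusion fails for `f = (re z)²` at the point `1`. Hence no closed proof
`cHodgeLaplacian_eq_two_smul_dolbeaultLaplacian_holds` can exist (universal closure:
`not_cHodgeLaplacian_eq_two_smul_dolbeaultLaplacian`, `KaehlerHodgeHarmonicCounterexample.lean`); the
intended statement — Voisin (2002), §6.1.2, Thm. 6.7 (p. 141), for Kähler, in particular complex,
manifolds — is the corrected named fact
`cHodgeLaplacian_eq_two_smul_dolbeaultLaplacian_of_isManifold_complex` (`KaehlerHodge.lean`). [folklore] -/
theorem not_cHodgeLaplacian_eq_two_smul_dolbeaultLaplacian :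
    ¬ cHodgeLaplacian_eq_two_smul_dolbeaultLaplacian (k := 0) (m := 2) flatMetric orient := fun H ↦
  cHodgeLaplacian_f0_ne (by norm_num) (H isKaehler_flatMetric (by norm_num) isSmoothForm_f0
    isSmoothForm_riemannianVolumeForm)

end ConjPlane

end Literature.NumberTheory.Transcendental
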